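import Summits.Ventures.Crystal3D.Theorems.StickyWulffConstantGenericWallFloorRefusalCount
import Summits.Ventures.Crystal3D.Theorems.StickyWulffConstantGenericWallFloorTwinTreeTerminal
import Summits.Ventures.Crystal3D.Theorems.StickyWulffConstantGenericWallFloorGeneralRungTubesSF
import Summits.Ventures.Crystal3D.Theorems.StickyWulffConstantCoaxialWallLawCreditLedger
import HarnessLib

/-!
# The general-filling rung for ALL non-co-axial pairs with an `h`-FREE charge (refusal walks)

HONEST FRAMING. Venture `Summits/Ventures/Crystal3D` (cell `crystal3d-full`), helper for the crux
`GenericWallFloor` (stmt-Ventures-19480) of `route-Ventures-StickyWulffConstant`, REGISTERED line `WallLedgerG`,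
open stub `stub_twoSlabAdhesion : TwoSlabAdhesion` (THE CRUX of the line).  Rung credit only; F-C1 not moved.

**Theorem (`general_twoSlabAdhesion_charge_of_not_coaxial`).**  Inputs `KissingGap δ`, `KissingClassification δ`
BY NAME (tree theorems at `δ = 5/2`).  For EVERY pair `(A₁, t₁, A₂, t₂)` satisfying the crux's non-co-axiality
hypothesis VERBATIM — the `Σ3ⁿ` twin-chain pairs INCLUDED — there are `κ > 0` (`κ = 2σ²/3721`, `σ` the sine of
the tilt of the pair's unique terminal twin family), `C` and `R₀ = 50` such that for every `h ≥ 0`, `ρ ≥ 50`,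
every `1`-separated `X` in the cell with the clamped samples `P₁ ⊆ Λ₁`, `P₂ ⊆ Λ₂` — EXACTLY the hypothesis list
of `stub_twoSlabAdhesion`, ARBITRARY filling —
`cross(P₁, X∖P₁) + cross(P₂, (X∖P₁)∖P₂) ≤ D((X∖P₁)∖P₂) + (φ₁ + φ₂)·π·ρ² − κ·ρ² + C·(1 + h)·ρ`.
So the wall between ANY two non-co-axial grains costs at least `κρ²` whatever fills it and however thick it is:
the qualitative content of the crux (`∃ c₀ > 0`) holds for every pair.  This supersedes the `h`-dependent
`general_twoSlabAdhesion_hcharge_of_not_coaxial` and removes the chain-pair exclusion of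
`general_twoSlabAdhesion_nonTriadic_sf`.

PROOF («refusal walks»): the twinning graph is a TREE (…TwinTree), so every coherent walk from the bottom grain
enters the terminal class across ONE plane family `± m` (…TwinTreeTerminal, `exists_admissible_frames`); run
ARCH v4's tube walks in tubes TILTED into that plane and REFUSE terminal mirrors by sliding up the plate
(…HexSteering, …PlateSlide, …RefusalWalk); every tube then pays inside itself, the count is injective
(…RefusalCount), and the interior ledger (`interior_ledger_ge_faces_add_unsaturated`) + `affineSampleDeficit_upper`
+ the deficiency splits give the inequality.
WHAT THIS IS NOT: not the stub — the charge is `κ = 2σ²/3721` (pair-dependent, tiny), not `1·π`; F-C1 not moved.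
-/

noncomputable section

namespace Summit.Ventures.Crystal3D.Theorems

open Summit.Ventures.Crystal3D Finset
open Literature.MathematicalPhysics.StatisticalMechanics (fccStacking contactDeficiency IsHaggSeq barlowStacking)
open scoped InnerProductSpace

/-- **Non-co-axial pairs are outside the terminal class** `{A₂(Λ₀), its horizontal twin}` (the two alternatives
are co-axial: `coaxial_of_image_eq`, resp. the in-plane hexagon is mirror-fixed and `coaxial_of_shared_adjacent_slots`). -/
theorem not_mem_terminalClass_of_not_coaxial
    (A₁ : EuclideanSpace ℝ (Fin 3) ≃ₗᵢ[ℝ] EuclideanSpace ℝ (Fin 3)) (t₁ : EuclideanSpace ℝ (Fin 3))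
    (A₂ : EuclideanSpace ℝ (Fin 3) ≃ₗᵢ[ℝ] EuclideanSpace ℝ (Fin 3)) (t₂ : EuclideanSpace ℝ (Fin 3))
    (hnc : ¬ ∃ (L : EuclideanSpace ℝ (Fin 3) ≃ₗᵢ[ℝ] EuclideanSpace ℝ (Fin 3))
        (s₁ s₂ : EuclideanSpace ℝ (Fin 3)) (σ σ' : ℤ → ℤ), IsHaggSeq σ ∧ IsHaggSeq σ' ∧
        (fun p => A₁ p + t₁) '' fccStacking 1 (Real.sqrt (2 / 3)) ⊆
          (fun p => L p + s₁) '' barlowStacking 1 (Real.sqrt (2 / 3)) σ ∧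
        (fun p => A₂ p + t₂) '' fccStacking 1 (Real.sqrt (2 / 3)) ⊆
          (fun p => L p + s₂) '' barlowStacking 1 (Real.sqrt (2 / 3)) σ') :
    A₁ ∉ {G : EuclideanSpace ℝ (Fin 3) ≃ₗᵢ[ℝ] EuclideanSpace ℝ (Fin 3) |
      G '' fccStacking 1 (Real.sqrt (2 / 3)) = A₂ '' fccStacking 1 (Real.sqrt (2 / 3)) ∨
      ((∀ w ∈ fccSlots, ⟪A₂ w, EuclideanSpace.single (2 : Fin 3) (1 : ℝ)⟫_ℝ = 0 ∨
          ⟪A₂ w, EuclideanSpace.single (2 : Fin 3) (1 : ℝ)⟫_ℝ = Real.sqrt (2 / 3) ∨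
          ⟪A₂ w, EuclideanSpace.single (2 : Fin 3) (1 : ℝ)⟫_ℝ = -Real.sqrt (2 / 3)) ∧
        G '' fccStacking 1 (Real.sqrt (2 / 3)) =
          (fun x => x - (2 * ⟪x, EuclideanSpace.single (2 : Fin 3) (1 : ℝ)⟫_ℝ) • EuclideanSpace.single (2 : Fin 3) (1 : ℝ)) ''
            (A₂ '' fccStacking 1 (Real.sqrt (2 / 3))))} := by
  set e₃ : EuclideanSpace ℝ (Fin 3) := EuclideanSpace.single (2 : Fin 3) (1 : ℝ) with he₃
  have he₃n : ‖e₃‖ = 1 := by rw [he₃, PiLp.norm_single, norm_one]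
  rintro (hEq | ⟨hm₂, hEq⟩)
  · exact hnc (coaxial_of_image_eq A₁ A₂ t₁ t₂ hEq)
  · obtain ⟨u₁, hu₁, u₂, hu₂, u₃, hu₃, hn₁, hn₂, hn₃, i12, i13, i23, -, -⟩ := exists_far_frame A₂ he₃n hm₂
    have hs12 : u₁ - u₂ ∈ fccSlots := sub_mem_fccSlots_of_inner_eq_half hu₁ hu₂ i12
    have hs13 : u₁ - u₃ ∈ fccSlots := sub_mem_fccSlots_of_inner_eq_half hu₁ hu₃ i13
    have hu1 : ⟪u₁, u₁⟫_ℝ = 1 := by rw [real_inner_self_eq_norm_sq, norm_eq_one_of_mem_fccSlots hu₁, one_pow]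
    have hab : ⟪A₂ (u₁ - u₂), A₂ (u₁ - u₃)⟫_ℝ = 1 / 2 := by
      rw [LinearIsometryEquiv.inner_map_map, inner_sub_left, inner_sub_right, inner_sub_right, hu1, i13,
        real_inner_comm u₁ u₂, i12, i23]; norm_num
    have hfix : ∀ {w}, w ∈ fccSlots → ⟪A₂ w, e₃⟫_ℝ = 0 →
        A₂ w ∈ (fun x => x - (2 * ⟪x, e₃⟫_ℝ) • e₃) '' (A₂ '' fccStacking 1 (Real.sqrt (2 / 3))) := by
      intro w hw h0
      refine ⟨A₂ w, ⟨w, mem_fcc_of_mem_fccSlots hw, rfl⟩, ?_⟩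
      show A₂ w - (2 * ⟪A₂ w, e₃⟫_ℝ) • e₃ = A₂ w
      rw [h0, mul_zero, zero_smul, sub_zero]
    have h12e : ⟪A₂ (u₁ - u₂), e₃⟫_ℝ = 0 := by rw [map_sub, inner_sub_left, hn₁, hn₂, sub_self]
    have h13e : ⟪A₂ (u₁ - u₃), e₃⟫_ℝ = 0 := by rw [map_sub, inner_sub_left, hn₁, hn₃, sub_self]
    refine hnc (coaxial_of_shared_adjacent_slots A₁ A₂ t₁ t₂ (A₂ (u₁ - u₂)) (A₂ (u₁ - u₃)) ?_ ?_
      ⟨u₁ - u₂, mem_fcc_of_mem_fccSlots hs12, rfl⟩ ⟨u₁ - u₃, mem_fcc_of_mem_fccSlots hs13, rfl⟩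
      (by rw [LinearIsometryEquiv.norm_map, norm_eq_one_of_mem_fccSlots hs12])
      (by rw [LinearIsometryEquiv.norm_map, norm_eq_one_of_mem_fccSlots hs13]) hab)
    · rw [hEq]; exact hfix hs12 h12e
    · rw [hEq]; exact hfix hs13 h13e

open scoped Classical in
/-- **The general-filling rung for all non-co-axial pairs, `h`-free charge.**  See the module docstring. -/
theorem general_twoSlabAdhesion_charge_of_not_coaxial {δ : ℝ} (hg : KissingGap δ) (hc : KissingClassification δ)
    (A₁ : EuclideanSpace ℝ (Fin 3) ≃ₗᵢ[ℝ] EuclideanSpace ℝ (Fin 3)) (t₁ : EuclideanSpace ℝ (Fin 3))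
    (A₂ : EuclideanSpace ℝ (Fin 3) ≃ₗᵢ[ℝ] EuclideanSpace ℝ (Fin 3)) (t₂ : EuclideanSpace ℝ (Fin 3))
    (hnc : ¬ ∃ (L : EuclideanSpace ℝ (Fin 3) ≃ₗᵢ[ℝ] EuclideanSpace ℝ (Fin 3))
        (s₁ s₂ : EuclideanSpace ℝ (Fin 3)) (σ σ' : ℤ → ℤ), IsHaggSeq σ ∧ IsHaggSeq σ' ∧
        (fun p => A₁ p + t₁) '' fccStacking 1 (Real.sqrt (2 / 3)) ⊆
          (fun p => L p + s₁) '' barlowStacking 1 (Real.sqrt (2 / 3)) σ ∧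
        (fun p => A₂ p + t₂) '' fccStacking 1 (Real.sqrt (2 / 3)) ⊆
          (fun p => L p + s₂) '' barlowStacking 1 (Real.sqrt (2 / 3)) σ') :
    ∃ κ : ℝ, 0 < κ ∧ ∃ C R₀ : ℝ, 1 ≤ R₀ ∧ ∀ h : ℝ, 0 ≤ h → ∀ ρ : ℝ, R₀ ≤ ρ →
      ∀ X P₁ P₂ : Finset (EuclideanSpace ℝ (Fin 3)),
      (∀ p ∈ X, ∀ q ∈ X, p ≠ q → 1 ≤ dist p q) → P₁ ⊆ X → P₂ ⊆ X \ P₁ →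
      (∀ p ∈ X, -(2 * R₀) ≤ p 2 ∧ p 2 ≤ h + 2 * R₀ ∧ p 0 ^ 2 + p 1 ^ 2 ≤ ρ ^ 2) →
      (∀ p, p ∈ P₁ ↔ (p ∈ (fun q => A₁ q + t₁) '' fccStacking 1 (Real.sqrt (2 / 3)) ∧
        -(2 * R₀) ≤ p 2 ∧ p 2 ≤ -R₀ ∧ p 0 ^ 2 + p 1 ^ 2 ≤ ρ ^ 2)) →
      (∀ p, p ∈ P₂ ↔ (p ∈ (fun q => A₂ q + t₂) '' fccStacking 1 (Real.sqrt (2 / 3)) ∧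
        h + R₀ ≤ p 2 ∧ p 2 ≤ h + 2 * R₀ ∧ p 0 ^ 2 + p 1 ^ 2 ≤ ρ ^ 2)) →
      ((((P₁ ×ˢ (X \ P₁)).filter fun pq => dist pq.1 pq.2 = 1).card : ℕ) : ℝ) +
        ((((P₂ ×ˢ ((X \ P₁) \ P₂)).filter fun pq => dist pq.1 pq.2 = 1).card : ℕ) : ℝ) ≤
        contactDeficiency ((X \ P₁) \ P₂) +
          (Real.sqrt 2 / 4 * ∑ᶠ w ∈ {w ∈ fccStacking 1 (Real.sqrt (2 / 3)) | ‖w‖ = 1},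
              |⟪w, A₁.symm (EuclideanSpace.single (2 : Fin 3) (1 : ℝ))⟫_ℝ| +
            Real.sqrt 2 / 4 * ∑ᶠ w ∈ {w ∈ fccStacking 1 (Real.sqrt (2 / 3)) | ‖w‖ = 1},
              |⟪w, A₂.symm (EuclideanSpace.single (2 : Fin 3) (1 : ℝ))⟫_ℝ|) * Real.pi * ρ ^ 2 -
          κ * ρ ^ 2 + C * (1 + h) * ρ := by
  set e₃ : EuclideanSpace ℝ (Fin 3) := EuclideanSpace.single (2 : Fin 3) (1 : ℝ) with he₃
  have he₃n : ‖e₃‖ = 1 := by rw [he₃, PiLp.norm_single, norm_one]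
  -- the admissible class and the terminal normal
  have hA₁ := not_mem_terminalClass_of_not_coaxial A₁ t₁ A₂ t₂ hnc
  obtain ⟨𝓐, m, hm, hmtilt, hA₁𝓐, h𝓐, hmir⟩ := exists_admissible_frames A₁ A₂ hA₁
  -- the tilted axis direction `z = (e₃ − ⟪e₃, m⟫ m)/σ`
  set c : ℝ := ⟪e₃, m⟫_ℝ with hcdef
  have hc2 : c ^ 2 < 1 := by rw [hcdef, real_inner_comm]; exact hmtilt
  set σ : ℝ := Real.sqrt (1 - c ^ 2) with hσdef
  have hσpos : 0 < σ := Real.sqrt_pos.2 (by linarith)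
  have hσsq : σ ^ 2 = 1 - c ^ 2 := Real.sq_sqrt (by linarith)
  have hσle : σ ≤ 1 := by
    have : Real.sqrt (1 - c ^ 2) ≤ Real.sqrt 1 := Real.sqrt_le_sqrt (by nlinarith [sq_nonneg c])
    rwa [Real.sqrt_one] at this
  set w₀ : EuclideanSpace ℝ (Fin 3) := e₃ - c • m with hw₀
  have hw₀m : ⟪w₀, m⟫_ℝ = 0 := by
    rw [hw₀, inner_sub_left, real_inner_smul_left, real_inner_self_eq_norm_sq, hm, hcdef]; ring
  have hw₀e : ⟪w₀, e₃⟫_ℝ = σ ^ 2 := by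
    rw [hw₀, inner_sub_left, real_inner_smul_left, real_inner_self_eq_norm_sq, he₃n, real_inner_comm, ← hcdef, hσsq]; ring
  have hw₀n : ‖w₀‖ ^ 2 = σ ^ 2 := by
    rw [hw₀, norm_sub_sq_real, he₃n, norm_smul, hm, mul_one, real_inner_smul_right, ← hcdef, Real.norm_eq_abs,
      sq_abs, hσsq]; ring
  set z : EuclideanSpace ℝ (Fin 3) := σ⁻¹ • w₀ with hzdef
  have hz : ‖z‖ = 1 := by
    have : ‖w₀‖ = σ := by
      have h0 := (sq_eq_sq₀ (norm_nonneg _) hσpos.le).1 hw₀n; exact h0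
    rw [hzdef, norm_smul, Real.norm_eq_abs, abs_of_pos (inv_pos.2 hσpos), this, inv_mul_cancel₀ hσpos.ne']
  have hzm : ⟪z, m⟫_ℝ = 0 := by rw [hzdef, real_inner_smul_left, hw₀m, mul_zero]
  have hze : ⟪z, e₃⟫_ℝ = σ := by
    rw [hzdef, real_inner_smul_left, hw₀e]; field_simp
  have he₃dec : e₃ = ⟪e₃, z⟫_ℝ • z + ⟪e₃, m⟫_ℝ • m := by
    rw [real_inner_comm, hze, hzdef, smul_smul, mul_inv_cancel₀ hσpos.ne', one_smul, ← hcdef, hw₀]; abel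
  -- the terminal class contains the top lattice
  have hT : ∀ G : EuclideanSpace ℝ (Fin 3) ≃ₗᵢ[ℝ] EuclideanSpace ℝ (Fin 3),
      G '' fccStacking 1 (Real.sqrt (2 / 3)) = A₂ '' fccStacking 1 (Real.sqrt (2 / 3)) →
      G ∈ {G : EuclideanSpace ℝ (Fin 3) ≃ₗᵢ[ℝ] EuclideanSpace ℝ (Fin 3) |
        G '' fccStacking 1 (Real.sqrt (2 / 3)) = A₂ '' fccStacking 1 (Real.sqrt (2 / 3)) ∨
        ((∀ w ∈ fccSlots, ⟪A₂ w, EuclideanSpace.single (2 : Fin 3) (1 : ℝ)⟫_ℝ = 0 ∨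
            ⟪A₂ w, EuclideanSpace.single (2 : Fin 3) (1 : ℝ)⟫_ℝ = Real.sqrt (2 / 3) ∨
            ⟪A₂ w, EuclideanSpace.single (2 : Fin 3) (1 : ℝ)⟫_ℝ = -Real.sqrt (2 / 3)) ∧
          G '' fccStacking 1 (Real.sqrt (2 / 3)) =
            (fun x => x - (2 * ⟪x, EuclideanSpace.single (2 : Fin 3) (1 : ℝ)⟫_ℝ) • EuclideanSpace.single (2 : Fin 3) (1 : ℝ)) ''
              (A₂ '' fccStacking 1 (Real.sqrt (2 / 3))))} := fun G hG => Or.inl hG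
  -- sample deficit upper bounds
  obtain ⟨C₁, hC₁⟩ := affineSampleDeficit_upper A₁ t₁ 50 (by norm_num)
  obtain ⟨C₂, hC₂⟩ := affineSampleDeficit_upper A₂ t₂ 50 (by norm_num)
  refine ⟨2 * σ ^ 2 / 3721, by positivity,
    (240 * Real.sqrt 2 * Real.pi + 3120 * (4 * 50 + 2)) / 2 + 1 + |C₁| + |C₂|, 50, by norm_num, ?_⟩
  intro h hh ρ hρ X P₁ P₂ hX hP₁X hP₂X hcell hP₁ hP₂
  set φ₁ : ℝ := Real.sqrt 2 / 4 * ∑ᶠ w ∈ {w ∈ fccStacking 1 (Real.sqrt (2 / 3)) | ‖w‖ = 1},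
      |⟪w, A₁.symm (EuclideanSpace.single (2 : Fin 3) (1 : ℝ))⟫_ℝ| with hφ₁
  set φ₂ : ℝ := Real.sqrt 2 / 4 * ∑ᶠ w ∈ {w ∈ fccStacking 1 (Real.sqrt (2 / 3)) | ‖w‖ = 1},
      |⟪w, A₂.symm (EuclideanSpace.single (2 : Fin 3) (1 : ℝ))⟫_ℝ| with hφ₂
  have hP₂X' : P₂ ⊆ X := hP₂X.trans Finset.sdiff_subset
  have hρ0 : (0 : ℝ) ≤ ρ := by linarith
  -- the interior ledger with the payer window `[−72, h + 54]`
  have hled := interior_ledger_ge_faces_add_unsaturated A₁ t₁ A₂ t₂ X P₁ P₂ 50 h ρ (by norm_num) hh hρ hX hcell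
    hP₁X hP₂X' hP₁ hP₂ (fun y => -(50 : ℝ) - 22 ≤ y 2 ∧ y 2 ≤ h + 50 + 4)
    (by intro y _ hy _; exact ⟨by linarith [hy.1], by linarith [hy.2]⟩)
  rw [← finsum_unit_fcc_symm_eq_sum_slots A₁, ← finsum_unit_fcc_symm_eq_sum_slots A₂, ← hφ₁, ← hφ₂] at hled
  simp only [] at hled
  set PAY := X.filter fun x => (X.filter fun q => dist x q = 1).card ≠ 12 ∧ -(50 : ℝ) - 22 ≤ x 2 ∧ x 2 ≤ h + 50 + 4
    with hPAY
  have hP0 : (0 : ℝ) ≤ (PAY.card : ℝ) := Nat.cast_nonneg _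
  -- the charge
  set S₀ : ℝ := (h + 3 * 50 + 21) / σ with hS₀
  have hS₀σ : σ * S₀ = h + 171 := by rw [hS₀]; field_simp; ring
  have hS₀0 : 0 ≤ S₀ := by rw [hS₀]; positivity
  have hcharge : 2 * σ ^ 2 / 3721 * ρ ^ 2 ≤ (PAY.card : ℝ) / 2 + (1 + h) * ρ := by
    have hσρ : σ ^ 2 * (S₀ + 23) ≤ h + 194 := by
      have e : σ ^ 2 * (S₀ + 23) = σ * (σ * S₀) + 23 * σ ^ 2 := by ring
      rw [e, hS₀σ]
      have h1 : σ * (h + 171) ≤ 1 * (h + 171) := mul_le_mul_of_nonneg_right hσle (by linarith)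
      nlinarith only [h1, hσle, hσpos]
    by_cases hbig : S₀ + 23 ≤ ρ
    · set u : ℝ := σ * (ρ - S₀ - 23) / 61 with hu
      have hu0 : 0 ≤ u := by rw [hu]; apply div_nonneg _ (by norm_num); exact mul_nonneg hσpos.le (by linarith)
      set M : ℕ := ⌊u⌋₊ with hMdef
      have hMle : (M : ℝ) ≤ u := Nat.floor_le hu0
      have hMlt : u < (M : ℝ) + 1 := Nat.lt_floor_add_one _
      have hM : 2 * (43 / σ * (M : ℝ)) ^ 2 ≤ (ρ - (h + 3 * 50 + 21) / σ - 23) ^ 2 := by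
        rw [← hS₀]
        have h1 : 43 / σ * (M : ℝ) ≤ 43 / 61 * (ρ - S₀ - 23) := by
          have := mul_le_mul_of_nonneg_left hMle (by positivity : (0 : ℝ) ≤ 43 / σ)
          have e : 43 / σ * u = 43 / 61 * (ρ - S₀ - 23) := by rw [hu]; field_simp
          linarith
        have h0 : 0 ≤ 43 / σ * (M : ℝ) := by positivity
        have h2 := pow_le_pow_left₀ h0 h1 2
        nlinarith only [h2, sq_nonneg (ρ - S₀ - 23)]
      have hcount := card_refusalPayers_ge hg hc X hX A₁ t₁ A₂ t₂ P₁ P₂ 50 h ρ (by norm_num) hρ hh hP₁X hP₂X'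
        (fun p hp => (hcell p hp).2.1) hP₁ hP₂ _ hT 𝓐 hA₁𝓐 h𝓐 hm hmir hz hzm hσpos (le_of_eq hze.symm) he₃dec
        (by rw [← hS₀]; exact hbig) M hM
      change (2 * M + 1) ^ 2 ≤ PAY.card at hcount
      have hcount' : (2 * (M : ℝ) + 1) ^ 2 ≤ (PAY.card : ℝ) := by exact_mod_cast hcount
      -- `P ≥ 4u² − 4u`
      have hP4 : 4 * u ^ 2 - 4 * u ≤ (PAY.card : ℝ) := by
        by_cases h2u : 0 ≤ 2 * u - 1
        · have := pow_le_pow_left₀ h2u (by linarith : 2 * u - 1 ≤ 2 * (M : ℝ) + 1) 2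
          nlinarith only [this, hcount']
        · push Not at h2u
          nlinarith only [h2u, hu0, hcount', sq_nonneg (2 * (M : ℝ) + 1)]
      -- `4u² ≥ (4σ²/3721)(ρ² − 2ρ(S₀+23))`, `4u ≤ 4ρ/61`
      have h4u2 : 4 * σ ^ 2 / 3721 * (ρ ^ 2 - 2 * ρ * (S₀ + 23)) ≤ 4 * u ^ 2 := by
        have e : 4 * u ^ 2 = 4 * σ ^ 2 / 3721 * (ρ - S₀ - 23) ^ 2 := by rw [hu]; ring
        rw [e]
        apply mul_le_mul_of_nonneg_left _ (by positivity)
        nlinarith only [sq_nonneg (S₀ + 23)]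
      have h4u : 4 * u ≤ 4 * ρ / 61 := by
        rw [hu]
        have : σ * (ρ - S₀ - 23) ≤ 1 * ρ := by
          have h1 : σ * (ρ - S₀ - 23) ≤ σ * ρ := mul_le_mul_of_nonneg_left (by linarith) hσpos.le
          have h2 : σ * ρ ≤ 1 * ρ := mul_le_mul_of_nonneg_right hσle hρ0
          linarith
        linarith
      have hlin : 4 * σ ^ 2 / 3721 * (2 * ρ * (S₀ + 23)) ≤ 8 * ρ * (h + 194) / 3721 := by
        have e : 4 * σ ^ 2 / 3721 * (2 * ρ * (S₀ + 23)) = 8 * ρ * (σ ^ 2 * (S₀ + 23)) / 3721 := by ring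
        rw [e]
        have := mul_le_mul_of_nonneg_left hσρ (by positivity : (0 : ℝ) ≤ 8 * ρ)
        linarith
      have e2 : 4 * σ ^ 2 / 3721 * (ρ ^ 2 - 2 * ρ * (S₀ + 23)) =
          4 * σ ^ 2 / 3721 * ρ ^ 2 - 4 * σ ^ 2 / 3721 * (2 * ρ * (S₀ + 23)) := by ring
      rw [e2] at h4u2
      have hhρ : 0 ≤ h * ρ := mul_nonneg hh hρ0
      nlinarith only [hP4, h4u2, h4u, hlin, hρ0, hhρ, hh]
    · push Not at hbig
      have h1 : 2 * σ ^ 2 / 3721 * ρ ^ 2 ≤ 2 * σ ^ 2 / 3721 * (ρ * (S₀ + 23)) := by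
        apply mul_le_mul_of_nonneg_left _ (by positivity)
        nlinarith only [hbig, hρ0]
      have h2 : 2 * σ ^ 2 / 3721 * (ρ * (S₀ + 23)) = 2 * ρ * (σ ^ 2 * (S₀ + 23)) / 3721 := by ring
      rw [h2] at h1
      have h3 := mul_le_mul_of_nonneg_left hσρ (by positivity : (0 : ℝ) ≤ 2 * ρ)
      have hhρ : 0 ≤ h * ρ := mul_nonneg hh hρ0
      nlinarith only [h1, h3, hP0, hρ0, hhρ, hh]
  -- the two upper slab counts and the two splits
  have hD₁ := hC₁ (-(2 * 50)) (-50) (by ring) ρ hρ P₁ hP₁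
  have hD₂ := hC₂ (h + 50) (h + 2 * 50) (by ring) ρ hρ P₂ hP₂
  have hsplit₁ := contactDeficiency_sdiff_split hP₁X
  have hsplit₂ := contactDeficiency_sdiff_split hP₂X
  have htwo := two_mul_contactDeficiency_eq_sum X
  have hb : C₁ * ρ ≤ |C₁| * (1 + h) * ρ := by
    have h1 : 0 ≤ (|C₁| - C₁) * ρ := mul_nonneg (by linarith only [le_abs_self C₁]) hρ0
    have h2 : 0 ≤ |C₁| * h * ρ := by positivity
    linarith only [h1, h2]
  have hc' : C₂ * ρ ≤ |C₂| * (1 + h) * ρ := by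
    have h1 : 0 ≤ (|C₂| - C₂) * ρ := mul_nonneg (by linarith only [le_abs_self C₂]) hρ0
    have h2 : 0 ≤ |C₂| * h * ρ := by positivity
    linarith only [h1, h2]
  have hhρ : 0 ≤ h * ρ := mul_nonneg hh hρ0
  linarith only [hled, hcharge, hD₁, hD₂, hsplit₁, hsplit₂, htwo, hb, hc', hρ0, hh, hhρ]

end Summit.Ventures.Crystal3D.Theorems

end
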